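import Mathlib
import Literature.MathematicalPhysics.QuantumFieldTheory.PottsGaugeEdwardsSokal
import HarnessLib

/-!
# Generalised Fortuin–Kasteleyn (Kawashima–Gubernatis) graphical representations and the
# Kandel–Domany freeze–delete representation of a local-interaction Gibbs weight
# (Gubernatis–Kawashima–Werner 2016 §6.2.1; Cataudella–Franzese–Nicodemi–Scala–Coniglio 1996 §3; Chayes–Machta 1998 §1)

SCOPE / HONEST FRAMING.  This file records, and PROVES (finite algebra, no named fact), the general
"graph decomposition" identities behind every FK/Edwards–Sokal-type representation, and their
simplest instance — the Kandel–Domany DELETION of a local Boltzmann factor against a constant floor.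
The instance applies verbatim to any lattice gauge theory whose Boltzmann weight is a finite product
of bounded local factors (e.g. the Wilson action of a compact group on a finite torus: configuration
type `X` arbitrary, reference measure arbitrary), and gives a *faithful, positive* graphical
representation in the sense of Chayes–Machta [ChayesMachta1998, §1 p. 478: "an expansion in
graphical elements such that each graphical configuration is endowed with a non-negative weight …
faithful: the expectation of any (local) observable … can be expressed as the expectation of a local
function in the graphical representation"].  It is NOT a *successful* representation in their sense
(no percolation signal is asserted), it carries no coin-tossing conditional law (GKW (6.13) fails for
continuous weights — which is why no cluster ALGORITHM for `SU(N)` follows), and nothing here bears on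
the Yang–Mills mass gap or on `Summit.QuantumFields.YangMills.Theses.BalabanLadder.IR`; in the `ym`
ladder only the conditional finite-`𝕋⁴` rung `BalabanLadder.UV` is closed (route R4), by other files.

Sources (read from the held copies; page numbers are PDF pages of the materialised texts).
* J. Gubernatis, N. Kawashima, P. Werner, *Quantum Monte Carlo Methods*, CUP 2016
  [GubernatisKawashimaWerner2016], §6.2.1 "General framework", pp. 169–170 of the held copy: a set of
  graphs `Γ`, a joint weight with `W(C) = Σ_{G ∈ Γ} W(C, G)` **(6.7)**, `P(G|C) = W(C,G)/W(C)`,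
  `P(C|G) = W(C,G)/W(G)`, `W(G) = Σ_C W(C,G)` **(6.8)**, the factorisation `W(C,G) = ∏_p w_p(C_p, G_p)`
  **(6.11)** with the local requirement `w_p(C_p) = Σ_{G_p} w_p(C_p, G_p)` **(6.12)** ("Because
  `Σ_G = ∏_p Σ_{G_p}`, (6.7) is satisfied"), and `P(G|C) = ∏_p P_p(G_p|C_p)`,
  `P_p(G_p|C_p) = w_p(C_p,G_p)/w_p(C_p)` **(6.14)–(6.15)** (the framework of Kawashima–Gubernatis,
  J. Stat. Phys. 80 (1995) 169, generalising Kandel–Domany, Phys. Rev. B 43 (1991) 8539 [KandelDomany1991]).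
* V. Cataudella, G. Franzese, M. Nicodemi, A. Scala, A. Coniglio, Phys. Rev. E 54 (1996) 175,
  arXiv:cond-mat/9604169 [CataudellaEtAl1996], §3 (PDF p. 5): for `H(σ) = Σ_l H_l(σ)` the
  "freezing and deleting operation" `Σ_{α(l)} w_{α(l)} e^{-β H̃_l(σ, c_{α(l)})} = e^{-β H_l(σ)}`
  (eq. `general_cond`) and `Z = Σ_{σ,C} ∏_l e^{-β H̃_l(σ,c_{α(l)})} w_{α(l)}` (eq. `Z_W`), "following
  the approach of Kandel et al.".
* L. Chayes, J. Machta, Physica A 254 (1998) 477–516 [ChayesMachta1998], §1 p. 478 (definitions of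
  graphical / faithful / successful representation quoted above; §2 eq. (2.4)–(2.5): FK weights on a
  generalised graph with "triangles, plaquettes, etc.").

## Content (everything PROVED; `X` is an arbitrary configuration type unless `[Fintype X]` is stated)

§1 General framework (`KDRep.unitWeight/totalWeight/jointWeight/graphCond`), for local data
`w : P → X → Γ → ℝ` on finitely many interaction units `P` with finitely many local graph labels `Γ`:
* `sum_jointWeight` — **(6.7)** from (6.11)–(6.12): `Σ_{G : P → Γ} ∏_p w_p(x, G_p) = ∏_p Σ_g w_p(x, g)`;
* `graphCond_eq_prod` — **(6.14)–(6.15)**: `P(G|x) = ∏_p w_p(x,G_p)/w_p(x)`; `sum_graphCond`;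
* faithfulness: `sum_totalWeight_mul` (finite `X`: `Σ_x W(x) F(x) = Σ_G Σ_x W(x,G) F(x)`) and
  `integral_totalWeight_mul` (any measure `μ` on `X`: `∫ W·F dμ = Σ_G ∫ W(·,G)·F dμ`).

§2 Kandel–Domany deletion against a floor (`Γ = Bool`: keep / delete), data `W : P → X → ℝ`,
floor `m : P → ℝ`: `kdLocal W m p x true = W_p(x) − m_p`, `… false = m_p`; retained-set form
`kdWeight W m x ω = (∏_{p ∈ ω} (W_p x − m_p)) · ∏_{p ∉ ω} m_p`:
* `sum_kdWeight` — `Σ_{ω ⊆ P} kdWeight(x, ω) = ∏_p W_p(x)` (the marginal on configurations is the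
  Gibbs weight); `kdWeight_nonneg` under `0 ≤ m_p ≤ W_p(x)` (positivity of the representation);
* `kdWeight_div_totalWeight` — the graph-given-configuration law is PRODUCT BERNOULLI: unit `p` is
  deleted with probability `m_p / W_p(x)` and retained with probability `1 − m_p / W_p(x)`;
* `kdWeight_eq_const_mul_prod` — given `ω`, the configuration weight is `const(ω) · ∏_{p∈ω}(W_p − m_p)`:
  deleted units drop out of the conditional law (the locality used by polymer / cluster arguments);
* `kdWeight_le_activity` — `kdWeight(x, ω) ≤ (∏_p m_p) · ∏_{p ∈ ω} (M_p/m_p − 1)` when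
  `0 < m_p ≤ W_p(x) ≤ M_p` (the per-configuration activity bound of the retained set);
* faithfulness `sum_prod_mul_eq_sum_kdWeight` / `integral_prod_mul_eq_sum_kdWeight`.

§3 Instance check: the generalised Edwards–Sokal coupling of Potts lattice gauge theory typed in
`PottsGaugeEdwardsSokal` IS the Kandel–Domany deletion of the plaquette factor
`W_σ(θ) = e^{-β(1 − 1{(δθ)_σ = 0})} ∈ {e^{-β}, 1}` against its floor `m = e^{-β}`:
`PlaquetteRC.esWeight_eq_kdWeight`.

NOT CLAIMED: any percolation/sharpness statement for the deletion representation of a non-abelian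
theory; any cluster algorithm; Kandel–Domany's general freeze (infinite-coupling) labels beyond the
abstract label type `Γ`.
-/

open Finset MeasureTheory

namespace Literature.MathematicalPhysics.QuantumFieldTheory

namespace KDRep

variable {P X Γ : Type*}

/-! ### §1 The Kawashima–Gubernatis general framework -/

/-- `w_p(C_p) = Σ_{G_p} w_p(C_p, G_p)`: the local weight of unit `p` recovered from its graph
decomposition. [cite: GubernatisKawashimaWerner2016, §6.2.1 eq. (6.12)] -/
def unitWeight [Fintype Γ] (w : P → X → Γ → ℝ) (p : P) (x : X) : ℝ := ∑ g, w p x g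

/-- `W(C) = ∏_p w_p(C_p)`: the (unnormalised) Gibbs weight as a product of local weights.
[cite: GubernatisKawashimaWerner2016, §6.1 eq. (6.4)] -/
def totalWeight [Fintype P] [Fintype Γ] (w : P → X → Γ → ℝ) (x : X) : ℝ := ∏ p, unitWeight w p x

/-- `W(C, G) = ∏_p w_p(C_p, G_p)`: the joint configuration–graph weight.
[cite: GubernatisKawashimaWerner2016, §6.2.1 eq. (6.11)] -/
def jointWeight [Fintype P] (w : P → X → Γ → ℝ) (x : X) (G : P → Γ) : ℝ := ∏ p, w p x (G p)

/-- `P(G | C) = W(C,G) / W(C)`: the law of the graph given the configuration.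
[cite: GubernatisKawashimaWerner2016, §6.2.1 eq. (6.8)] -/
noncomputable def graphCond [Fintype P] [Fintype Γ] (w : P → X → Γ → ℝ) (x : X) (G : P → Γ) : ℝ :=
  jointWeight w x G / totalWeight w x

/-- `W(G) = Σ_C W(C, G)`: the graph marginal (finite configuration space).
[cite: GubernatisKawashimaWerner2016, §6.2.1, display after (6.8)] -/
def graphMarginal [Fintype X] [Fintype P] (w : P → X → Γ → ℝ) (G : P → Γ) : ℝ := ∑ x, jointWeight w x G

/-- Unfolding of `unitWeight`: `w_p(C_p) = Σ_{G_p} w_p(C_p, G_p)`.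
[cite: GubernatisKawashimaWerner2016, §6.2.1 eq. (6.12)] -/
theorem unitWeight_def [Fintype Γ] (w : P → X → Γ → ℝ) (p : P) (x : X) :
    unitWeight w p x = ∑ g, w p x g := rfl

/-- Unfolding of `jointWeight`: `W(C,G) = ∏_p w_p(C_p, G_p)`.
[cite: GubernatisKawashimaWerner2016, §6.2.1 eq. (6.11)] -/
theorem jointWeight_def [Fintype P] (w : P → X → Γ → ℝ) (x : X) (G : P → Γ) :
    jointWeight w x G = ∏ p, w p x (G p) := rfl

/-- **(6.7) from (6.11)–(6.12)**: summing the joint weight over all graphs returns the Gibbs weight,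
`Σ_G W(C,G) = W(C)` ("Because `Σ_G = ∏_p Σ_{G_p}`, (6.7) is satisfied").
[cite: GubernatisKawashimaWerner2016, §6.2.1 eqs. (6.7), (6.11), (6.12)] -/
theorem sum_jointWeight [Fintype P] [DecidableEq P] [Fintype Γ] (w : P → X → Γ → ℝ) (x : X) :
    ∑ G : P → Γ, jointWeight w x G = totalWeight w x := by
  unfold jointWeight totalWeight unitWeight
  rw [Finset.prod_univ_sum, Fintype.piFinset_univ]

/-- Non-negative local data give a non-negative joint weight ("each graphical configuration is
endowed with a non-negative weight"). [cite: ChayesMachta1998, §1 p. 478] -/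
theorem jointWeight_nonneg [Fintype P] {w : P → X → Γ → ℝ} (hw : ∀ p x g, 0 ≤ w p x g) (x : X) (G : P → Γ) :
    0 ≤ jointWeight w x G :=
  Finset.prod_nonneg fun p _ => hw p x (G p)

/-- Non-negative local data give non-negative local weights `w_p(C_p) ≥ 0`.
[cite: GubernatisKawashimaWerner2016, §6.2.1 eq. (6.12)] -/
theorem unitWeight_nonneg [Fintype Γ] {w : P → X → Γ → ℝ} (hw : ∀ p x g, 0 ≤ w p x g) (p : P) (x : X) :
    0 ≤ unitWeight w p x :=
  Finset.sum_nonneg fun g _ => hw p x g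

/-- Non-negative local data give a non-negative Gibbs weight `W(C) ≥ 0`.
[cite: GubernatisKawashimaWerner2016, §6.1 eq. (6.4)] -/
theorem totalWeight_nonneg [Fintype P] [Fintype Γ] {w : P → X → Γ → ℝ} (hw : ∀ p x g, 0 ≤ w p x g) (x : X) :
    0 ≤ totalWeight w x :=
  Finset.prod_nonneg fun p _ => unitWeight_nonneg hw p x

/-- **(6.14)–(6.15)**: the graph-given-configuration law is a product over units of the local laws
`P_p(G_p | C_p) = w_p(C_p, G_p) / w_p(C_p)`.
[cite: GubernatisKawashimaWerner2016, §6.2.1 eqs. (6.14)–(6.15)] -/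
theorem graphCond_eq_prod [Fintype P] [Fintype Γ] (w : P → X → Γ → ℝ) (x : X) (G : P → Γ) :
    graphCond w x G = ∏ p, w p x (G p) / unitWeight w p x := by
  unfold graphCond jointWeight totalWeight
  rw [Finset.prod_div_distrib]

/-- The graph-given-configuration law is a probability: `Σ_G P(G | C) = 1` whenever `W(C) ≠ 0`.
[cite: GubernatisKawashimaWerner2016, §6.2.1 eqs. (6.7)–(6.8)] -/
theorem sum_graphCond [Fintype P] [DecidableEq P] [Fintype Γ] (w : P → X → Γ → ℝ) {x : X} (hx : totalWeight w x ≠ 0) :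
    ∑ G : P → Γ, graphCond w x G = 1 := by
  unfold graphCond
  rw [← Finset.sum_div, sum_jointWeight, div_self hx]

/-- `P(G | C) ≥ 0` for non-negative local data. [cite: GubernatisKawashimaWerner2016, §6.2.1 eq. (6.8)] -/
theorem graphCond_nonneg [Fintype P] [Fintype Γ] {w : P → X → Γ → ℝ} (hw : ∀ p x g, 0 ≤ w p x g) (x : X) (G : P → Γ) :
    0 ≤ graphCond w x G :=
  div_nonneg (jointWeight_nonneg hw x G) (totalWeight_nonneg hw x)

/-- `P(C | G) · W(G) = W(C, G) = P(G | C) · W(C)`: the two conditionals of (6.8) are the two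
disintegrations of the same joint weight. [cite: GubernatisKawashimaWerner2016, §6.2.1 eq. (6.8)] -/
theorem graphCond_mul_totalWeight [Fintype P] [Fintype Γ] (w : P → X → Γ → ℝ) {x : X} (hx : totalWeight w x ≠ 0)
    (G : P → Γ) : graphCond w x G * totalWeight w x = jointWeight w x G := by
  unfold graphCond; rw [div_mul_cancel₀ _ hx]

/-- FAITHFULNESS, finite configuration space: the Gibbs expectation of any observable is the
graph-mixture of the joint weights, `Σ_C W(C) F(C) = Σ_G Σ_C W(C,G) F(C)`.
[cite: ChayesMachta1998, §1 p. 478; GubernatisKawashimaWerner2016, §6.2.1 eq. (6.7)] -/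
theorem sum_totalWeight_mul [Fintype X] [Fintype P] [DecidableEq P] [Fintype Γ] (w : P → X → Γ → ℝ) (F : X → ℝ) :
    ∑ x, totalWeight w x * F x = ∑ G : P → Γ, ∑ x, jointWeight w x G * F x := by
  rw [Finset.sum_comm]
  refine Finset.sum_congr rfl fun x _ => ?_
  rw [← Finset.sum_mul, sum_jointWeight]

/-- `Σ_G W(G) = Σ_C W(C)`: total mass is preserved. [cite: GubernatisKawashimaWerner2016, §6.2.1 eq. (6.7)] -/
theorem sum_graphMarginal [Fintype X] [Fintype P] [DecidableEq P] [Fintype Γ] (w : P → X → Γ → ℝ) :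
    ∑ G : P → Γ, graphMarginal w G = ∑ x, totalWeight w x := by
  have h := sum_totalWeight_mul w fun _ => 1
  simp only [mul_one] at h
  rw [h]; rfl

/-- FAITHFULNESS, arbitrary configuration space with a reference measure `μ` (e.g. a product of Haar
measures for a lattice gauge theory): `∫ W·F dμ = Σ_G ∫ W(·,G)·F dμ`, provided each summand is
integrable. [cite: ChayesMachta1998, §1 p. 478; GubernatisKawashimaWerner2016, §6.2.1 eq. (6.7)] -/
theorem integral_totalWeight_mul [Fintype P] [DecidableEq P] [Fintype Γ] {mX : MeasurableSpace X} (μ : Measure X)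
    (w : P → X → Γ → ℝ) (F : X → ℝ)
    (hint : ∀ G : P → Γ, Integrable (fun x => jointWeight w x G * F x) μ) :
    ∫ x, totalWeight w x * F x ∂μ = ∑ G : P → Γ, ∫ x, jointWeight w x G * F x ∂μ := by
  rw [← integral_finsetSum _ fun G _ => hint G]
  refine integral_congr_ae (Filter.Eventually.of_forall fun x => ?_)
  simp only
  rw [← Finset.sum_mul, sum_jointWeight]

/-! ### §2 The Kandel–Domany deletion of a local factor against a constant floor -/

/-- Local keep/delete data: unit `p` contributes `W_p(x) − m_p` when RETAINED (`true`) and the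
constant floor `m_p` when DELETED (`false`); `(W_p − m_p) + m_p = W_p` is Cataudella et al.'s
`general_cond` with two "interaction configurations" per unit (the deleted one being `J' = 0`).
[cite: CataudellaEtAl1996, §3 eq. (general_cond)] (the scheme of [KandelDomany1991]) -/
def kdLocal (W : P → X → ℝ) (m : P → ℝ) : P → X → Bool → ℝ :=
  fun p x b => if b then W p x - m p else m p

/-- Retained-set form of the Kandel–Domany joint weight:
`kdWeight(x, ω) = ∏_{p ∈ ω} (W_p(x) − m_p) · ∏_{p ∉ ω} m_p`.
[cite: CataudellaEtAl1996, §3 eq. (Z_W)] (the scheme of [KandelDomany1991]) -/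
def kdWeight [Fintype P] [DecidableEq P] (W : P → X → ℝ) (m : P → ℝ) (x : X) (ω : Finset P) : ℝ :=
  (∏ p ∈ ω, (W p x - m p)) * ∏ p ∈ ωᶜ, m p

/-- The keep/delete data recover the local factor: `(W_p − m_p) + m_p = W_p` (Cataudella et al.'s
`general_cond` for the two-label unit). [cite: CataudellaEtAl1996, §3 eq. (general_cond)] -/
theorem unitWeight_kdLocal (W : P → X → ℝ) (m : P → ℝ) (p : P) (x : X) :
    unitWeight (kdLocal W m) p x = W p x := by
  simp [unitWeight, kdLocal]

/-- The keep/delete data recover the Gibbs weight `∏_p W_p`.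
[cite: CataudellaEtAl1996, §3 eqs. (general_cond), (Z_W)] -/
theorem totalWeight_kdLocal [Fintype P] (W : P → X → ℝ) (m : P → ℝ) (x : X) :
    totalWeight (kdLocal W m) x = ∏ p, W p x := by
  simp [totalWeight, unitWeight_kdLocal]

/-- The retained-set weight is the joint weight (6.11) of §1 for the graph `G = 1_ω`.
[cite: GubernatisKawashimaWerner2016, §6.2.1 eq. (6.11)] -/
theorem kdWeight_eq_jointWeight [Fintype P] [DecidableEq P] (W : P → X → ℝ) (m : P → ℝ) (x : X)
    (ω : Finset P) :
    kdWeight W m x ω = jointWeight (kdLocal W m) x (fun p => decide (p ∈ ω)) := by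
  unfold kdWeight jointWeight kdLocal
  rw [← Finset.prod_mul_prod_compl ω]
  congr 1
  · exact Finset.prod_congr rfl fun p hp => by simp [hp]
  · exact Finset.prod_congr rfl fun p hp => by simp [Finset.mem_compl.mp hp]

/-- **Marginal identity** (`general_cond` ⟹ `Z_W`): summing the Kandel–Domany weight over all
retained sets returns the Gibbs weight, `Σ_{ω ⊆ P} ∏_{p∈ω}(W_p − m_p) ∏_{p∉ω} m_p = ∏_p W_p`.
[cite: CataudellaEtAl1996, §3 eqs. (general_cond), (Z_W); GubernatisKawashimaWerner2016, §6.2.1 eq. (6.7)] -/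
theorem sum_kdWeight [Fintype P] [DecidableEq P] (W : P → X → ℝ) (m : P → ℝ) (x : X) :
    ∑ ω : Finset P, kdWeight W m x ω = ∏ p, W p x := by
  have h := Finset.prod_add (fun p => W p x - m p) (fun p => m p) (Finset.univ : Finset P)
  simp only [sub_add_cancel, Finset.powerset_univ] at h
  rw [h]
  refine Finset.sum_congr rfl fun ω _ => ?_
  unfold kdWeight
  rw [Finset.compl_eq_univ_sdiff]

/-- POSITIVITY: with a genuine floor `0 ≤ m_p ≤ W_p(x)` every graphical configuration has
non-negative weight (Chayes–Machta's requirement for a graphical representation).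
[cite: ChayesMachta1998, §1 p. 478] -/
theorem kdWeight_nonneg [Fintype P] [DecidableEq P] {W : P → X → ℝ} {m : P → ℝ} {x : X}
    (hm : ∀ p, 0 ≤ m p) (hW : ∀ p, m p ≤ W p x) (ω : Finset P) : 0 ≤ kdWeight W m x ω :=
  mul_nonneg (Finset.prod_nonneg fun p _ => sub_nonneg.mpr (hW p))
    (Finset.prod_nonneg fun p _ => hm p)

/-- LOCALITY GIVEN THE GRAPH: for a fixed retained set `ω` the configuration dependence of the joint
weight is only through the retained factors, `kdWeight(x, ω) = (∏_{p∉ω} m_p) · ∏_{p∈ω}(W_p(x) − m_p)`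
— deleted units drop out of the conditional law `P(C | G)`.
[cite: CataudellaEtAl1996, §3 ("Spins that are connected by infinite strength interaction are frozen
while the others do not interact"); GubernatisKawashimaWerner2016, §6.2.1 eq. (6.8)] -/
theorem kdWeight_eq_const_mul_prod [Fintype P] [DecidableEq P] (W : P → X → ℝ) (m : P → ℝ) (x : X)
    (ω : Finset P) : kdWeight W m x ω = (∏ p ∈ ωᶜ, m p) * ∏ p ∈ ω, (W p x - m p) :=
  mul_comm _ _

/-- **Deletion probabilities**: given the configuration, the retained set is PRODUCT BERNOULLI —
unit `p` is deleted with probability `m_p / W_p(x)` and retained with probability `1 − m_p / W_p(x)`: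
`kdWeight(x, ω) / ∏_p W_p(x) = ∏_{p∈ω}(1 − m_p/W_p(x)) · ∏_{p∉ω} m_p/W_p(x)`.
[cite: GubernatisKawashimaWerner2016, §6.2.1 eqs. (6.14)–(6.15); CataudellaEtAl1996, §3] -/
theorem kdWeight_div_totalWeight [Fintype P] [DecidableEq P] (W : P → X → ℝ) (m : P → ℝ) {x : X}
    (hW : ∀ p, W p x ≠ 0) (ω : Finset P) :
    kdWeight W m x ω / ∏ p, W p x =
      (∏ p ∈ ω, (1 - m p / W p x)) * ∏ p ∈ ωᶜ, (m p / W p x) := by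
  unfold kdWeight
  rw [← Finset.prod_mul_prod_compl ω (fun p => W p x), mul_div_mul_comm,
    ← Finset.prod_div_distrib, ← Finset.prod_div_distrib]
  congr 1
  exact Finset.prod_congr rfl fun p _ => by rw [sub_div, div_self (hW p)]

/-- The deletion law is a probability: `Σ_ω kdWeight(x, ω) / ∏_p W_p(x) = 1`.
[cite: GubernatisKawashimaWerner2016, §6.2.1 eqs. (6.7)–(6.8)] -/
theorem sum_kdWeight_div [Fintype P] [DecidableEq P] (W : P → X → ℝ) (m : P → ℝ) {x : X}
    (hW : ∏ p, W p x ≠ 0) : ∑ ω : Finset P, kdWeight W m x ω / ∏ p, W p x = 1 := by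
  rw [← Finset.sum_div, sum_kdWeight, div_self hW]

/-- **Activity bound for the retained set**: if `0 < m_p ≤ W_p(x) ≤ M_p` for every unit then
`kdWeight(x, ω) ≤ (∏_p m_p) · ∏_{p ∈ ω} (M_p / m_p − 1)` — relative to the fully deleted ("free")
weight `∏_p m_p`, each retained unit costs at most the activity `M_p/m_p − 1`, which is small when
the local factor is nearly constant (e.g. `e^{2|β| ‖S_p‖∞} − 1` for a Boltzmann factor
`e^{-β S_p}`).  An elementary corollary (our proof) of the deletion decomposition.
[cite: CataudellaEtAl1996, §3 eq. (Z_W)] -/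
theorem kdWeight_le_activity [Fintype P] [DecidableEq P] {W : P → X → ℝ} {m M : P → ℝ} {x : X}
    (hm : ∀ p, 0 < m p) (hW : ∀ p, m p ≤ W p x) (hM : ∀ p, W p x ≤ M p) (ω : Finset P) :
    kdWeight W m x ω ≤ (∏ p, m p) * ∏ p ∈ ω, (M p / m p - 1) := by
  rw [← Finset.prod_mul_prod_compl ω m, mul_right_comm, ← Finset.prod_mul_distrib]
  unfold kdWeight
  refine mul_le_mul_of_nonneg_right ?_ (Finset.prod_nonneg fun p _ => (hm p).le)
  refine Finset.prod_le_prod (fun p _ => sub_nonneg.mpr (hW p)) fun p _ => ?_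
  rw [mul_sub, mul_one, mul_div_cancel₀ _ (hm p).ne']
  exact sub_le_sub_right (hM p) _

/-- FAITHFULNESS of the deletion representation, finite configuration space:
`Σ_x (∏_p W_p x) F x = Σ_ω Σ_x kdWeight(x, ω) F x`. [cite: ChayesMachta1998, §1 p. 478] -/
theorem sum_prod_mul_eq_sum_kdWeight [Fintype X] [Fintype P] [DecidableEq P] (W : P → X → ℝ) (m : P → ℝ)
    (F : X → ℝ) :
    ∑ x, (∏ p, W p x) * F x = ∑ ω : Finset P, ∑ x, kdWeight W m x ω * F x := by
  rw [Finset.sum_comm]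
  refine Finset.sum_congr rfl fun x _ => ?_
  rw [← Finset.sum_mul, sum_kdWeight]

/-- FAITHFULNESS of the deletion representation against an arbitrary reference measure (e.g. product
Haar measure of a lattice gauge theory on a finite torus):
`∫ (∏_p W_p) F dμ = Σ_ω ∫ kdWeight(·, ω) F dμ`. [cite: ChayesMachta1998, §1 p. 478] -/
theorem integral_prod_mul_eq_sum_kdWeight [Fintype P] [DecidableEq P] {mX : MeasurableSpace X} (μ : Measure X)
    (W : P → X → ℝ) (m : P → ℝ) (F : X → ℝ)
    (hint : ∀ ω : Finset P, Integrable (fun x => kdWeight W m x ω * F x) μ) :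
    ∫ x, (∏ p, W p x) * F x ∂μ = ∑ ω : Finset P, ∫ x, kdWeight W m x ω * F x ∂μ := by
  rw [← integral_finsetSum _ fun ω _ => hint ω]
  refine integral_congr_ae (Filter.Eventually.of_forall fun x => ?_)
  simp only
  rw [← Finset.sum_mul, sum_kdWeight]

end KDRep

/-! ### §3 Instance: the generalised Edwards–Sokal coupling of Potts lattice gauge theory is the
Kandel–Domany deletion of the plaquette Boltzmann factor against its floor -/

namespace PlaquetteRC

open LatticeForm KDRep

variable {d L : ℕ} [NeZero L] (G : Type*) [AddCommGroup G] [DecidableEq G]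

/-- The normalised plaquette Boltzmann factor of Potts lattice gauge theory,
`W_σ(θ) = e^{-β} · e^{β·1{(δθ)_σ = 0}} ∈ {e^{-β}, 1}` (the factor `e^{β·1{flat}}` of
`pottsWeight` times the constant `e^{-β}`). [cite: DuncanSchweinhart2025, §1.1] -/
noncomputable def plaqFactor (β : ℝ) (σ : Plaquette d L) (θ : Site d L → Fin d → G) : ℝ :=
  if res (td₁ θ) σ = 0 then 1 else Real.exp (-β)

/-- The generalised Edwards–Sokal weight of `PottsGaugeEdwardsSokal` (open plaquettes `ω`, parameter
`p = 1 − e^{-β}`) coincides with the Kandel–Domany deletion weight of the plaquette factors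
`plaqFactor` against the constant floor `e^{-β}`: retained = open, deleted = closed.
[cite: DuncanSchweinhart2025, Prop. 21; CataudellaEtAl1996, §3] -/
theorem esWeight_eq_kdWeight (β : ℝ) (θ : Site d L → Fin d → G) (ω : Finset (Plaquette d L)) :
    esWeight G β θ ω =
      kdWeight (fun σ θ' => plaqFactor G β σ θ') (fun _ => Real.exp (-β)) θ ω := by
  unfold esWeight kdWeight plaqFactor esParam
  rw [← Finset.prod_mul_prod_compl ω]
  congr 1
  · refine Finset.prod_congr rfl fun σ hσ => ?_
    by_cases h : res (td₁ θ) σ = 0 <;> simp [hσ, h]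
  · refine Finset.prod_congr rfl fun σ hσ => ?_
    simp [Finset.mem_compl.mp hσ]

/-- Consequently the first marginal of the Edwards–Sokal coupling (Prop. 20, proved in
`PottsGaugeEdwardsSokal` as `sum_esWeight_eq_pottsWeight`) is an instance of the Kandel–Domany
marginal identity: `Σ_ω esWeight = ∏_σ plaqFactor_σ(θ)`. [cite: DuncanSchweinhart2025, Prop. 20] -/
theorem sum_esWeight_eq_prod_plaqFactor (β : ℝ) (θ : Site d L → Fin d → G) :
    ∑ ω : Finset (Plaquette d L), esWeight G β θ ω = ∏ σ, plaqFactor G β σ θ := by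
  simp_rw [esWeight_eq_kdWeight]
  exact sum_kdWeight _ _ _

end PlaquetteRC

end Literature.MathematicalPhysics.QuantumFieldTheory
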